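import Literature.AnabelianGeometry.AbsoluteAnabelian.LogFrobeniusCoreRigidCalibration
import HarnessLib

/-!
# [AbsTopIII] Cor. 5.5: the vocabulary predicate `InFirstRows` (p. 130) and the named clause `Cor55CoreRigid`
# ((v), p. 131) — universal closures FALSE, in the FACT-LIST's `not_forall_` naming (proof-only companion)

S. Mochizuki, *Topics in Absolute Anabelian Geometry III: Global Reconstruction Algorithms*, J. Math. Sci.
Univ. Tokyo **22** (2015) [AbsTopIII] §5, Corollary 5.5, kurims pp. 129–133
[cite: MochizukiAbsTopIII2015, Cor 5.5 p. 130].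

Two rows of the cell's frozen FACT-LIST over abc-iut-L4-t3's `LogFrobeniusCompatibility.lean` /
abc-iut-w5-d112's `LogFrobeniusRigidity.lean`:

* **F-0136 `DVertex.InFirstRows`** (p. 130, "the subdiagram of categories determined by the first `n` of the
  seven rows", label «model-witness» via `core_mem_two`): a DEFINITION — `x.InFirstRows k :↔ x` is a vertex of
  `D•` proper of row `≤ k`.  Its universal closure "EVERY vertex of `D•⊢` lies in the first `k` rows for EVERY
  `k`" is false: the vertex `ℰ•` of row 7 (`DVertex.e7`) is not in `D•_{≤6}`, and the mono-analytic vertex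
  `ℰ⊢` (`DVertex.emono7`) is in no `D•_{≤k}` at all (`not_forall_inFirstRows`; closed witnesses
  `not_inFirstRows_six_e7`, `not_inFirstRows_emono7`).  Instance forms print uses: `□ ∈ D•_{≤2}`,
  `𝒳_n ∈ D•_{≤2}` (`LogFrobeniusSetting.core_mem_two`, `LogFrobeniusSetting.row1_mem_two`, cited in the census).
* **F-0155 `LogFrobeniusSetting.Cor55CoreRigid`** (Cor. 5.5 (v) second clause, "`D•` is totally `□`-rigid",
  label «fact-open (REDUCED: `cor55CoreRigid_iff`)»): abc-iut's `LogFrobeniusCoreRigidCalibration.lean` already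
  proves BOTH `exists_cor55CoreRigid` (diagonal setting on the id-rigid category `Type u`) AND
  `exists_not_cor55CoreRigid` (diagonal setting on `AddCommGrpCat`, where negation is a non-trivial natural
  automorphism of the identity); this file only records the latter in the closure form the FACT-LIST renderer
  reads, `not_forall_cor55CoreRigid : ¬ ∀ Vmod isArc L, L.Cor55CoreRigid` (universe level `0`, index set
  `PUnit`), with the satisfiability half beside it in the census.  As that file's docstring says, F-0155 is thereby
  INDEPENDENT of the interface: a genuine property (id-rigidity of print's `Th•_T[Z]`, "immediate from the
  definitions", p. 133) correctly carried as a named hypothesis at the genuine setting — nothing about print is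
  impugned.

PROOF-ONLY (abc-iut cell, block C / W6, seat abc-iut-w6-d028, C3 default = FACT-LIST proving; no definition, no
instance).  Refereed pre-IUT anabelian geometry, DEGENERATE calibration witnesses with no arithmetic content;
nothing here bears on [IUTchIII] Cor. 3.12 or takes a side; refuted-as-closure is a statement about OUR typing's
binders, not about the paper.
-/

universe u

open CategoryTheory

namespace Literature.AnabelianGeometry.AbsoluteAnabelian

/-! ### F-0136 `DVertex.InFirstRows` ([AbsTopIII] Cor. 5.5 p. 130) -/

namespace DVertex

variable {Vmod : Type u} {isArc : Vmod → Bool}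

/-- `ℰ•` (row 7 of `D•`) is not a vertex of `D•_{≤6}`. [cite: MochizukiAbsTopIII2015, Cor 5.5 p. 130] -/
theorem not_inFirstRows_six_e7 : ¬ (DVertex.e7 : DVertex Vmod isArc).InFirstRows 6 := by
  rintro ⟨-, h⟩
  simp [DVertex.row] at h

/-- The mono-analytic vertex `ℰ⊢` (glued part `D⊢`) lies in NO `D•_{≤k}` (it is not a vertex of `D•` proper).
[cite: MochizukiAbsTopIII2015, Cor 5.10 p. 146] -/
theorem not_inFirstRows_emono7 (k : ℕ) : ¬ (DVertex.emono7 : DVertex Vmod isArc).InFirstRows k :=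
  fun h => h.1

/-- `x ∈ D•_{≤k}` forces `row x ≤ k`; in particular no vertex lies in `D•_{≤0}`.
[cite: MochizukiAbsTopIII2015, Cor 5.5 p. 130] -/
theorem not_inFirstRows_zero (x : DVertex Vmod isArc) : ¬ x.InFirstRows 0 := by
  rintro ⟨-, h⟩
  cases x <;> simp [DVertex.row] at h

/-- **The universal closure of the vocabulary predicate `DVertex.InFirstRows` is FALSE** (FACT-LIST F-0136: a
definition, not a hypothesis).  Binders exactly those of the declaration, universe level `0`; witness: index set
`PUnit`, all places archimedean, `k = 6`, `x = ℰ•`. [cite: MochizukiAbsTopIII2015, Cor 5.5 p. 130] -/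
theorem not_forall_inFirstRows :
    ¬ ∀ (Vmod : Type) (isArc : Vmod → Bool) (k : ℕ) (x : DVertex Vmod isArc),
        Literature.AnabelianGeometry.AbsoluteAnabelian.DVertex.InFirstRows k x :=
  fun h => not_inFirstRows_six_e7 (h PUnit (fun _ => true) 6 DVertex.e7)

/-- **Census of F-0136**: the closure is false, while the instance forms print uses hold — `□ ∈ D•_{≤2}` and
`𝒳_n ∈ D•_{≤2}` (`LogFrobeniusSetting.core_mem_two`, `LogFrobeniusSetting.row1_mem_two`), and `ℰ• ∈ D•_{≤7}`.
[cite: MochizukiAbsTopIII2015, Cor 5.5 p. 130] -/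
theorem inFirstRows_schema_census (n : ℤ) :
    (¬ ∀ (Vmod : Type) (isArc : Vmod → Bool) (k : ℕ) (x : DVertex Vmod isArc),
        Literature.AnabelianGeometry.AbsoluteAnabelian.DVertex.InFirstRows k x) ∧
      (DVertex.core : DVertex Vmod isArc).InFirstRows 2 ∧
      (DVertex.row1 n : DVertex Vmod isArc).InFirstRows 2 ∧
      (DVertex.e7 : DVertex Vmod isArc).InFirstRows 7 :=
  ⟨not_forall_inFirstRows, LogFrobeniusSetting.core_mem_two, LogFrobeniusSetting.row1_mem_two n,
    ⟨trivial, le_rfl⟩⟩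

end DVertex

/-! ### F-0155 `LogFrobeniusSetting.Cor55CoreRigid` ([AbsTopIII] Cor. 5.5 (v) p. 131) -/

namespace LogFrobeniusSetting

/-- **The universal closure of the named clause `LogFrobeniusSetting.Cor55CoreRigid` is FALSE** (FACT-LIST F-0155),
in the renderer's `not_forall_` form: abc-iut's `exists_not_cor55CoreRigid` (diagonal setting on `AddCommGrpCat`,
negation a non-trivial natural automorphism of `𝟭`) at the index set `PUnit`, universe level `0`.  Binders exactly
those of the declaration. [cite: MochizukiAbsTopIII2015, Cor 5.5 (v) p. 131] -/
theorem not_forall_cor55CoreRigid :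
    ¬ ∀ (Vmod : Type) (isArc : Vmod → Bool) (L : LogFrobeniusSetting Vmod isArc),
        Literature.AnabelianGeometry.AbsoluteAnabelian.LogFrobeniusSetting.Cor55CoreRigid L := by
  intro h
  obtain ⟨L, hL⟩ := exists_not_cor55CoreRigid PUnit.{1} (fun _ => true)
  exact hL (h PUnit (fun _ => true) L)

/-- **Census of F-0155** (calibration, both signs, abc-iut `LogFrobeniusCoreRigidCalibration.lean`): the closure is
false, `Cor55CoreRigid` HOLDS at some setting over every index set (`exists_cor55CoreRigid`, diagonal on `Type u`)
and FAILS at another (`exists_not_cor55CoreRigid`), and it is EQUIVALENT to id-rigidity of the single category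
`𝒳 = Th•_T[Z]` (`cor55CoreRigid_iff`, the printed proof p. 133) — so F-0155 is a genuine hypothesis on print's
`𝒳`, independent of the interface. [cite: MochizukiAbsTopIII2015, Cor 5.5 (v) p. 133] -/
theorem cor55CoreRigid_schema_census (Vmod : Type u) (isArc : Vmod → Bool) (L : LogFrobeniusSetting Vmod isArc) :
    (¬ ∀ (Vmod : Type) (isArc : Vmod → Bool) (L : LogFrobeniusSetting Vmod isArc),
        Literature.AnabelianGeometry.AbsoluteAnabelian.LogFrobeniusSetting.Cor55CoreRigid L) ∧
      (∃ L : LogFrobeniusSetting Vmod isArc, L.Cor55CoreRigid) ∧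
      (∃ L : LogFrobeniusSetting Vmod isArc, ¬ L.Cor55CoreRigid) ∧
      (L.Cor55CoreRigid ↔ IsIdRigid L.X) :=
  ⟨not_forall_cor55CoreRigid, exists_cor55CoreRigid Vmod isArc, exists_not_cor55CoreRigid Vmod isArc,
    L.cor55CoreRigid_iff⟩

end LogFrobeniusSetting

end Literature.AnabelianGeometry.AbsoluteAnabelian
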